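import Mathlib

/-!
# `SnSubsetDichotomy.HyperoctahedralThreshold`, line `refutation-local-symmetry` — stub `stub_pathGadget`

The path gadget (crux `stmt-MatrixMultiplication-10883`, registered stub `stub_pathGadget` of the
lead's skeleton for line `refutation-local-symmetry`).

Data: three involutions `μ 0, μ 1, μ 2` of `Fin n` and a clean path of the rung graph between two
loop rungs: `k + 1` rungs `{p j, q j}` (`j : Fin (k + 1)`, all `2 (k + 1)` points distinct) and
`k + 2` colour slots `col : Fin (k + 2) → Fin 3`; slot `0` is a loop at rung `0`
(`μ (col 0)` swaps `p 0` and `q 0`), slot `j + 1` (`j : Fin k`) is the step from rung `j` to rung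
`j + 1` (`μ (col (j + 1))` maps `p j ↦ p (j + 1)` and `q j ↦ q (j + 1)`), slot `k + 1` is a loop at
rung `k`, and consecutive slots carry distinct colours.  Claim: a commuting pair of involutions
`a, b`, not both trivial, supported on the points of the path, with `a ∈ C(μ 0)`, `b ∈ C(μ 1)` and
`a * b ∈ C(μ 2)`.

Proof.  Rung `j` *sees* the two (distinct) colours of the slots `j` and `j + 1`.  Encode the points
by the injection `g : Fin (k + 1) × Bool → Fin n`, `(j, false) ↦ p j`, `(j, true) ↦ q j`, let
`e c` be the involution of `Fin (k + 1) × Bool` flipping the Boolean coordinate over the rungs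
seeing `c`, and let `A c` be its extension along `g` (`Equiv.Perm.extendDomain`), i.e. the product
of the transpositions `(p j q j)` over the rungs seeing `c`.  Since every rung sees exactly two of
the three colours, `e 0 * e 1 = e 2`; all `e c` commute and square to `1`, hence so do the `A c`,
and we take `a := A 0`, `b := A 1` (so `a * b = A 2`).  Commutation `A c ∈ C(μ c)`: if rung `j` sees
`c` then `μ c` maps the rung `{p j, q j}` onto a rung `{p j', q j'}` which again sees `c` — onto
itself with the two sides swapped when `c` is the colour of a loop slot at an end rung, and onto
the neighbouring rung, sides preserved, when `c` is the colour of a step slot (using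
`μ c * μ c = 1` to walk a step backwards) — and this is compatible with the flips; a point not on a
rung seeing `c` is fixed by `A c`, and so is its `μ c`-image (otherwise, applying the involution
`μ c`, the point itself would lie on a rung seeing `c`).  Finally rung `0` sees two distinct
colours, one of which is `0` or `1`, so `a (p 0) = q 0 ≠ p 0` or `b (p 0) = q 0 ≠ p 0`.
-/

namespace Summit.MatrixMultiplication.MatrixMultiplication.Theorems.HyperoctahedralThreshold

open Equiv

namespace PathGadget

/-- Transport of commutation.  Let `A : Perm β` act as `e : Perm α` on the points `g x` and fix
every other point, let `μ` be an involution of `β`, and let `S ⊆ α` contain every point moved by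
`e`.  If `μ` maps each `g x`, `x ∈ S`, to some `g y`, `y ∈ S`, compatibly with `e`
(`μ (g (e x)) = g (e y)`), then `A` commutes with `μ`. [folklore] -/
theorem mul_comm_of_transport {α β : Type*} (A μ : Perm β) (g : α → β) (e : Perm α) (S : Set α)
    (hAg : ∀ x, A (g x) = g (e x)) (hAfix : ∀ w, (∀ x, g x ≠ w) → A w = w)
    (hμ : ∀ w, μ (μ w) = w) (hfix : ∀ x, x ∉ S → e x = x)
    (hmap : ∀ x ∈ S, ∃ y ∈ S, μ (g x) = g y ∧ μ (g (e x)) = g (e y)) :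
    A * μ = μ * A := by
  -- `A` fixes every point not of the form `g x`, `x ∈ S`
  have hfixβ : ∀ w, (¬∃ x ∈ S, w = g x) → A w = w := by
    intro w hw
    by_cases hr : ∃ x, g x = w
    · obtain ⟨x, rfl⟩ := hr
      rw [hAg, hfix x fun hx => hw ⟨x, hx, rfl⟩]
    · push Not at hr
      exact hAfix w hr
  ext w : 1
  rw [Perm.mul_apply, Perm.mul_apply]
  by_cases hw : ∃ x ∈ S, w = g x
  · obtain ⟨x, hx, rfl⟩ := hw
    obtain ⟨y, -, h1, h2⟩ := hmap x hx
    rw [h1, hAg, hAg, h2]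
  · rw [hfixβ w hw, hfixβ (μ w) ?_]
    rintro ⟨y, hy, hyw⟩
    obtain ⟨y', hy', h1, -⟩ := hmap y hy
    exact hw ⟨y', hy', by rw [← hμ w, hyw, h1]⟩

/-- The rung map of a clean path: if rung `j` sees colour `c`, then `μ c` maps the rung
`{p j, q j}` onto a rung `{p j', q j'}` seeing `c`, either preserving or swapping the two sides.
[folklore] -/
theorem rung_map {n k : ℕ} (μ : Fin 3 → Perm (Fin n)) (p q : Fin (k + 1) → Fin n)
    (col : Fin (k + 2) → Fin 3) (hμ : ∀ c v, μ c (μ c v) = v)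
    (h0 : μ (col 0) (p 0) = q 0)
    (hlast : μ (col (Fin.last (k + 1))) (p (Fin.last k)) = q (Fin.last k))
    (hstep : ∀ j : Fin k, μ (col j.succ.castSucc) (p j.castSucc) = p j.succ ∧
      μ (col j.succ.castSucc) (q j.castSucc) = q j.succ)
    (c : Fin 3) (j : Fin (k + 1)) (hj : col j.castSucc = c ∨ col j.succ = c) :
    ∃ j' : Fin (k + 1), (col j'.castSucc = c ∨ col j'.succ = c) ∧
      ((μ c (p j) = p j' ∧ μ c (q j) = q j') ∨ (μ c (p j) = q j' ∧ μ c (q j) = p j')) := by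
  rcases hj with hj | hj
  · -- the slot `j.castSucc` (between rungs `j - 1` and `j`, or the loop at rung `0`) has colour `c`
    rcases Fin.eq_zero_or_eq_succ j with rfl | ⟨i, rfl⟩
    · -- loop at rung `0`
      rw [Fin.castSucc_zero] at hj
      subst hj
      exact ⟨0, Or.inl (by rw [Fin.castSucc_zero]), Or.inr ⟨h0, by rw [← h0, hμ]⟩⟩
    · -- the step from rung `i.castSucc` to rung `i.succ`, walked backwards
      subst hj
      refine ⟨i.castSucc, Or.inr (by rw [Fin.succ_castSucc]), Or.inl ⟨?_, ?_⟩⟩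
      · conv_lhs => rw [← (hstep i).1]
        exact hμ _ _
      · conv_lhs => rw [← (hstep i).2]
        exact hμ _ _
  · -- the slot `j.succ` (between rungs `j` and `j + 1`, or the loop at rung `k`) has colour `c`
    rcases Fin.eq_castSucc_or_eq_last j with ⟨i, rfl⟩ | rfl
    · -- the step from rung `i.castSucc` to rung `i.succ`
      rw [Fin.succ_castSucc] at hj
      subst hj
      exact ⟨i.succ, Or.inl rfl, Or.inl (hstep i)⟩
    · -- loop at rung `k`
      rw [Fin.succ_last] at hj
      subst hj
      exact ⟨Fin.last k, Or.inr (by rw [Fin.succ_last]), Or.inr ⟨hlast, by rw [← hlast, hμ]⟩⟩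

end PathGadget

open PathGadget in
/-- **Stub `stub_pathGadget` — the path gadget** (line `refutation-local-symmetry` of crux
`SnSubsetDichotomy.HyperoctahedralThreshold`, stmt-MatrixMultiplication-10883).  A clean path of
the rung graph of three involutions `μ 0, μ 1, μ 2` of `Fin n` between two loop rungs carries a
commuting pair of involutions `a ∈ C(μ 0)`, `b ∈ C(μ 1)`, not both trivial, with
`a * b ∈ C(μ 2)`, supported on the points of the path: `a` (resp. `b`, `a * b`) is the product of
the rung transpositions `(p j q j)` over the rungs seeing colour `0` (resp. `1`, `2`), realised as
`Equiv.Perm.extendDomain` of a Boolean flip along the point injection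
`Fin (k + 1) × Bool → Fin n` (`PathGadget.mul_comm_of_transport`, `PathGadget.rung_map`).
[folklore] -/
theorem stub_pathGadget : ∀ (n k : ℕ) (μ : Fin 3 → Equiv.Perm (Fin n)) (p q : Fin (k + 1) → Fin n) (col : Fin (k + 2) → Fin 3), (∀ c, μ c * μ c = 1) → Function.Injective p → Function.Injective q → (∀ i j, p i ≠ q j) → μ (col 0) (p 0) = q 0 → μ (col (Fin.last (k + 1))) (p (Fin.last k)) = q (Fin.last k) → (∀ j : Fin k, μ (col j.succ.castSucc) (p j.castSucc) = p j.succ ∧ μ (col j.succ.castSucc) (q j.castSucc) = q j.succ) → (∀ i : Fin (k + 1), col i.castSucc ≠ col i.succ) → ∃ a b : Equiv.Perm (Fin n), a * a = 1 ∧ b * b = 1 ∧ a * b = b * a ∧ (a ≠ 1 ∨ b ≠ 1) ∧ a * μ 0 = μ 0 * a ∧ b * μ 1 = μ 1 * b ∧ a * b * μ 2 = μ 2 * (a * b) ∧ (∀ v, (a v ≠ v ∨ b v ≠ v) → ∃ i, v = p i ∨ v = q i) := by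
  intro n k μ p q col hμ hp hq hpq h0 hlast hstep hcol
  classical
  have hμv : ∀ c v, μ c (μ c v) = v := fun c v => by
    rw [← Perm.mul_apply, hμ c, Perm.one_apply]
  -- the points of the path: `(j, false) ↦ p j`, `(j, true) ↦ q j`
  obtain ⟨g, hgp, hgq⟩ : ∃ g : Fin (k + 1) × Bool → Fin n,
      (∀ j, g (j, false) = p j) ∧ ∀ j, g (j, true) = q j :=
    ⟨fun x => bif x.2 then q x.1 else p x.1, fun _ => rfl, fun _ => rfl⟩
  have hg : Function.Injective g := by
    rintro ⟨i, _ | _⟩ ⟨j, _ | _⟩ h <;> simp only [hgp, hgq] at h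
    · rw [hp h]
    · exact absurd h (hpq i j)
    · exact absurd h.symm (hpq j i)
    · rw [hq h]
  -- `R c j`: rung `j` sees colour `c`
  obtain ⟨R, hR⟩ : ∃ R : Fin 3 → Fin (k + 1) → Prop,
      ∀ c j, R c j ↔ (col j.castSucc = c ∨ col j.succ = c) :=
    ⟨fun c j => col j.castSucc = c ∨ col j.succ = c, fun _ _ => Iff.rfl⟩
  -- the local flips: swap the two sides of the rungs seeing `c`
  obtain ⟨e, he⟩ : ∃ e : Fin 3 → Perm (Fin (k + 1) × Bool),
      ∀ c j b, e c (j, b) = (j, if R c j then !b else b) :=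
    ⟨fun c => Function.Involutive.toPerm (fun x => (x.1, if R c x.1 then !x.2 else x.2))
      fun x => by by_cases h : R c x.1 <;> simp [h], fun _ _ _ => rfl⟩
  -- transported to `Fin n` along `g`
  set F := Equiv.ofInjective g hg
  have hFg : ∀ (f : Perm (Fin (k + 1) × Bool)) (x), f.extendDomain F (g x) = g (f x) :=
    fun f x => f.extendDomain_apply_image F x
  have hFfix : ∀ (f : Perm (Fin (k + 1) × Bool)) (w), (∀ x, g x ≠ w) → f.extendDomain F w = w :=
    fun f w hw => f.extendDomain_apply_not_subtype F (by rintro ⟨x, hx⟩; exact hw x hx)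
  -- the three local involutions commute with their colours
  have hcomm : ∀ c, (e c).extendDomain F * μ c = μ c * (e c).extendDomain F := fun c => by
    refine mul_comm_of_transport ((e c).extendDomain F) (μ c) g (e c) {x | R c x.1} (hFg (e c))
      (hFfix (e c)) (hμv c) ?_ ?_
    · rintro ⟨j, b⟩ hj
      simp only [Set.mem_setOf_eq] at hj
      rw [he, if_neg hj]
    · rintro ⟨j, b⟩ hj
      simp only [Set.mem_setOf_eq] at hj
      obtain ⟨j', hj', hmap⟩ := rung_map μ p q col hμv h0 hlast hstep c j ((hR c j).1 hj)
      have hRj' : R c j' := (hR c j').2 hj'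
      rcases hmap with ⟨hpj, hqj⟩ | ⟨hpj, hqj⟩
      · refine ⟨(j', b), hRj', ?_⟩
        cases b <;>
          simp only [he, if_pos hj, if_pos hRj', Bool.not_false, Bool.not_true, hgp, hgq]
        exacts [⟨hpj, hqj⟩, ⟨hqj, hpj⟩]
      · refine ⟨(j', !b), hRj', ?_⟩
        cases b <;>
          simp only [he, if_pos hj, if_pos hRj', Bool.not_false, Bool.not_true, hgp, hgq]
        exacts [⟨hpj, hqj⟩, ⟨hqj, hpj⟩]
  -- flip algebra: every rung sees exactly two of the three colours
  have h3 : ∀ j, R 2 j ↔ ¬(R 0 j ↔ R 1 j) := fun j => by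
    rw [hR, hR, hR]
    have key : ∀ x y : Fin 3, x ≠ y →
        ((x = 2 ∨ y = 2) ↔ ¬((x = 0 ∨ y = 0) ↔ (x = 1 ∨ y = 1))) := by decide
    exact key _ _ (hcol j)
  have hsq : ∀ c, e c * e c = 1 := fun c => by
    ext ⟨j, b⟩ : 1
    simp only [Perm.mul_apply, Perm.one_apply, he]
    by_cases h : R c j <;> simp [h]
  have h01 : e 0 * e 1 = e 1 * e 0 := by
    ext ⟨j, b⟩ : 1
    simp only [Perm.mul_apply, he]
    by_cases h0 : R 0 j <;> by_cases h1 : R 1 j <;> simp [h0, h1]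
  have h012 : e 0 * e 1 = e 2 := by
    ext ⟨j, b⟩ : 1
    simp only [Perm.mul_apply, he]
    have := h3 j
    by_cases h0 : R 0 j <;> by_cases h1 : R 1 j <;> simp_all
  refine ⟨(e 0).extendDomain F, (e 1).extendDomain F, ?_, ?_, ?_, ?_, hcomm 0, hcomm 1, ?_, ?_⟩
  · rw [Perm.extendDomain_mul, hsq, Perm.extendDomain_one]
  · rw [Perm.extendDomain_mul, hsq, Perm.extendDomain_one]
  · rw [Perm.extendDomain_mul, Perm.extendDomain_mul, h01]
  · -- not both trivial: rung `0` sees colour `0` or colour `1`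
    have hR01 : R 0 0 ∨ R 1 0 := by
      rw [hR, hR]
      have key : ∀ x y : Fin 3, x ≠ y → (x = 0 ∨ y = 0) ∨ (x = 1 ∨ y = 1) := by decide
      exact key _ _ (hcol 0)
    have hne : ∀ c, R c 0 → (e c).extendDomain F ≠ 1 := fun c hc h1 => by
      have h := Equiv.congr_fun h1 (p 0)
      rw [Perm.one_apply, ← hgp, hFg, he, if_pos hc, Bool.not_false, hgq, hgp] at h
      exact hpq 0 0 h.symm
    exact hR01.imp (hne 0) (hne 1)
  · rw [Perm.extendDomain_mul, h012]
    exact hcomm 2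
  · -- support
    intro v hv
    by_contra hv'
    push Not at hv'
    have hgv : ∀ x, g x ≠ v := by
      rintro ⟨i, _ | _⟩
      · rw [hgp]
        exact (hv' i).1.symm
      · rw [hgq]
        exact (hv' i).2.symm
    exact hv.elim (fun h => h (hFfix _ v hgv)) fun h => h (hFfix _ v hgv)

end Summit.MatrixMultiplication.MatrixMultiplication.Theorems.HyperoctahedralThreshold
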